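import Summits.QuantumAdvantage.QuantumAdvantage.Theorems.CubicForrelationNearExactIsExactTwelveWindowRelBent
import Summits.QuantumAdvantage.QuantumAdvantage.Theorems.CubicForrelationNearExactIsExactTwelveWindow953

/-!
# Crux `CubicForrelation.NearExactIsExact` (stmt-QuantumAdvantage-14043) — n = 12: the window `(59/64, 1)` is EMPTY, `θ₁₂ ≤ 59/64`

Certificate seat `b2b-cforr-cert` (gen 14).  HONEST FRAMING: a kernel-checked THEOREM (standard axioms, no `decide`/`native_decide`) about
the finite slice n = 12 of the crux: no cubic `f, g : 𝔽₂¹² → 𝔽₂` has `59/64 < Φ(f,g) < 1`.  With the record `57/64` and the tree's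
`isolation_twelve_953` this gives `θ₁₂ ∈ [57/64, 59/64]` (`theta_twelve_closed_5964`).  NOT summit progress (the crux needs one `θ < 1` for
every even n).

Proof (write-up: HOME `b2b-cforr-cert-g14/PROOF-N12-5964.md`).  By `window_twelve_structure` both sides are at level 5 with odd hyperplanes
`P_g, P_f`, exact off them, with an odd-kind wild point.  §1–§4 (`…Hyperplane`, `…HalfSpectrum`, `…Pairing`, `…RelBent`): the residual
`e_g = u' − 2(−1)^f` is (anti)periodic along the normal `c` of `P_f`; its sign pattern on `P_g` is `σ = (−1)^{D̄}` with `D̄` QUADRATIC;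
`G = σ1_{P_g}` is relatively bent: `W_G = 64τ` on `P_f`, `τ = ±1`, with an affine translation law.  This file:
* `tw59_parity_pair`, `tw59_flat3_even`: a `±1` function with the affine translation law has an even number of `+1`'s on every parametrised
  3-flat of `P_f` (pair points along the first direction);
* `tw59_window_empty`: the agreement set `A = {τ = σ'} ⊂ P_f` (`σ'` the f-side quadratic sign) has `16384·#A ≤ Σ W_R² = 4096 Σ R² < 2²²`, so
  `#A < 256`, but is an even-on-3-flats set, so by the Reed–Muller bound on the 11-flat (`erm_weight_ge`, r = 2) `A = ∅`; then
  `W_R = −64(e_f − σ')` on `P_f` with `|W_R| ≤ Σ|R| < 256` and `4 ∣ e_f − σ'` force `e_f = σ' = ±1` on `P_f` — contradicting the f-side wild point;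
* `isolation_twelve_5964` (`Φ > 59/64 ⇒ Φ = 1` at `Fin 12`), `theta_twelve_closed_5964` (`θ₁₂ ∈ [57/64, 59/64]`), `no_window_twelve_5964`.

References: Ax (1964) / McEliece (1972); MacWilliams–Sloane (1977) Ch. 13 §3, Ch. 15; Rothaus (1976); Carlet (CUP 2021) §2–6;
O'Donnell (2014) §3.3.  Everything below is proved from Mathlib and the tree; axioms are the standard three.
-/

set_option linter.dupNamespace false -- D-0017: single-problem summit ⇒ `QuantumAdvantage.QuantumAdvantage` by design

noncomputable section

namespace Summit.QuantumAdvantage.QuantumAdvantage.Theorems.CubicForrelation.NearExactIsExact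

open Finset
open Literature.Computability.QuantumComplexity
open Literature.Computability.QuantumComplexity.BuzetChailloux (bxor zeroVec bxor_bxor_cancel_left bxor_zeroVec zeroVec_bxor bxor_comm
  bxor_self twist_zeroVec_right twist_bxor_right signOf_sq)
open Literature.Computability.QuantumComplexity.Simon (twist_eq_one_or)
open Literature.Computability.QuantumComplexity.DerivativeWalsh (W twist_bxor_left sum_W_sq)

/-! ### Parity on parametrised flats from an affine translation law -/

/-- **Pairing along the first direction.**  If `ψ(w ⊕ t₀) = χ(w)ψ(w)` with `ψ, χ = ±1` at the points of the flat `b ⊕ ⟨t⟩`, then the number of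
`+1`'s of `ψ` on the flat `b ⊕ ⟨t₀, t⟩` is even iff the number of `−1`'s of `χ` on `b ⊕ ⟨t⟩` is even. [this work] -/
theorem tw59_parity_pair {n k : ℕ} (ψ χ : (Fin n → Bool) → ℝ) (b t₀ : Fin n → Bool) (t : Fin k → Fin n → Bool)
    (hψ : ∀ ε : Fin k → Bool, ψ (fun j => b j ^^ decide (Odd #(univ.filter fun i => ε i && t i j))) = 1 ∨
      ψ (fun j => b j ^^ decide (Odd #(univ.filter fun i => ε i && t i j))) = -1)
    (hχ : ∀ ε : Fin k → Bool, χ (fun j => b j ^^ decide (Odd #(univ.filter fun i => ε i && t i j))) = 1 ∨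
      χ (fun j => b j ^^ decide (Odd #(univ.filter fun i => ε i && t i j))) = -1)
    (htr : ∀ w, ψ (bxor w t₀) = χ w * ψ w) :
    Even #(univ.filter fun ε : Fin (k + 1) → Bool =>
        ψ (fun j => b j ^^ decide (Odd #(univ.filter fun i => ε i && (Fin.cons t₀ t : Fin (k + 1) → Fin n → Bool) i j))) = 1) ↔
      Even #(univ.filter fun ε : Fin k → Bool => χ (fun j => b j ^^ decide (Odd #(univ.filter fun i => ε i && t i j))) = -1) := by
  rw [erm_card_split]
  have e0 : ∀ ε : Fin k → Bool, (fun j => b j ^^ decide (Odd #(univ.filter fun i : Fin (k + 1) =>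
      (Fin.cons false ε : Fin (k + 1) → Bool) i && (Fin.cons t₀ t : Fin (k + 1) → Fin n → Bool) i j))) =
      fun j => b j ^^ decide (Odd #(univ.filter fun i => ε i && t i j)) := by
    intro ε; rw [erm_flatPt_cons]; funext j; simp
  have e1 : ∀ ε : Fin k → Bool, (fun j => b j ^^ decide (Odd #(univ.filter fun i : Fin (k + 1) =>
      (Fin.cons true ε : Fin (k + 1) → Bool) i && (Fin.cons t₀ t : Fin (k + 1) → Fin n → Bool) i j))) =
      bxor (fun j => b j ^^ decide (Odd #(univ.filter fun i => ε i && t i j))) t₀ := by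
    intro ε; rw [erm_flatPt_cons]; funext j; simp [bxor]
  simp only [e0, e1, htr]
  rw [card_filter, card_filter, card_filter, ← sum_add_distrib]
  have hpt : ∀ ε : Fin k → Bool,
      (if ψ (fun j => b j ^^ decide (Odd #(univ.filter fun i => ε i && t i j))) = 1 then 1 else 0) +
        (if χ (fun j => b j ^^ decide (Odd #(univ.filter fun i => ε i && t i j))) *
            ψ (fun j => b j ^^ decide (Odd #(univ.filter fun i => ε i && t i j))) = 1 then 1 else 0) =
      2 * (if χ (fun j => b j ^^ decide (Odd #(univ.filter fun i => ε i && t i j))) = 1 ∧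
            ψ (fun j => b j ^^ decide (Odd #(univ.filter fun i => ε i && t i j))) = 1 then 1 else 0) +
        (if χ (fun j => b j ^^ decide (Odd #(univ.filter fun i => ε i && t i j))) = -1 then 1 else 0) := by
    intro ε
    rcases hψ ε with h1 | h1 <;> rcases hχ ε with h2 | h2 <;> rw [h1, h2] <;> norm_num
  rw [sum_congr rfl fun ε _ => hpt ε, sum_add_distrib, ← mul_sum, ← card_filter]
  rw [Nat.even_add, Iff.comm]
  constructor
  · intro h; exact (iff_of_true (even_two_mul _) h)
  · intro h; exact h.1 (even_two_mul _)

/-- **Even parity on 3-flats.**  Let `ψ = ±1` on the hyperplane `{(−1)^{c·w} = t_f}` and suppose that for every direction `m` of it there are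
`κ = ±1`, `a` with `ψ(w ⊕ m) = κ(−1)^{a·w}ψ(w)` for all `w`.  Then `ψ` has an even number of `+1`'s on every parametrised 3-flat of the
hyperplane (pair along `t₀`; the remaining affine sign on a 2-flat has evenly many `−1`'s, by pairing again). [this work] -/
theorem tw59_flat3_even (c : Fin (6 + 6) → Bool) (tf : ℝ) (ψ : (Fin (6 + 6) → Bool) → ℝ)
    (hψ : ∀ w, twist c w = tf → (ψ w = 1 ∨ ψ w = -1))
    (htr : ∀ m, twist c m = 1 → ∃ (κ : ℝ) (a : Fin (6 + 6) → Bool), (κ = 1 ∨ κ = -1) ∧ ∀ w, ψ (bxor w m) = κ * twist a w * ψ w)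
    (b : Fin (6 + 6) → Bool) (hb : twist c b = tf) (t : Fin 3 → Fin (6 + 6) → Bool) (ht : ∀ i, twist c (t i) = 1) :
    Even #(univ.filter fun ε : Fin 3 → Bool => ψ (fun j => b j ^^ decide (Odd #(univ.filter fun i => ε i && t i j))) = 1) := by
  -- flat points stay on the hyperplane
  set V₀ := univ.filter (fun a : Fin (6 + 6) → Bool => twist c a = 1) with hV₀
  have h0 : zeroVec ∈ V₀ := by rw [hV₀, mem_filter]; exact ⟨mem_univ _, twist_zeroVec_right c⟩
  have hPV : ∀ x, twist c x = tf → ∀ a ∈ V₀, twist c (bxor x a) = tf := by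
    intro x hx a ha; rw [hV₀, mem_filter] at ha; rw [twist_bxor_right, hx, ha.2, mul_one]
  have hmem : ∀ (k : ℕ) (s : Fin k → Fin (6 + 6) → Bool), (∀ i, twist c (s i) = 1) → ∀ ε : Fin k → Bool,
      twist c (fun j => b j ^^ decide (Odd #(univ.filter fun i => ε i && s i j))) = tf := by
    intro k s hs ε
    exact ws_flatPt_mem V₀ h0 (fun w => twist c w = tf) hPV k b hb s (fun i => by rw [hV₀, mem_filter]; exact ⟨mem_univ _, hs i⟩) ε
  -- split `t = (t 0) :: tail`
  have et : t = Fin.cons (t 0) (Fin.tail t) := (Fin.cons_self_tail t).symm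
  obtain ⟨κ, a, hκ, hκtr⟩ := htr (t 0) (ht 0)
  have htail : ∀ i, twist c (Fin.tail t i) = 1 := fun i => ht i.succ
  have hχv : ∀ w : Fin (6 + 6) → Bool, κ * twist a w = 1 ∨ κ * twist a w = -1 := by
    intro w; rcases hκ with h | h <;> rcases twist_eq_one_or a w with h' | h' <;> rw [h, h'] <;> norm_num
  rw [et, tw59_parity_pair ψ (fun w => κ * twist a w) b (t 0) (Fin.tail t) (fun ε => hψ _ (hmem 2 _ htail ε)) (fun ε => hχv _)
    (fun w => by rw [hκtr w])]
  -- on the 2-flat: `#{χ = −1} = 4 − #{χ = 1}`, and `#{χ = 1}` is even by pairing again (constant factor `(−1)^{a·t₁}`)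
  set t' : Fin 2 → Fin (6 + 6) → Bool := Fin.tail t with ht'
  have hsplit : #(univ.filter fun ε : Fin 2 → Bool =>
        κ * twist a (fun j => b j ^^ decide (Odd #(univ.filter fun i => ε i && t' i j))) = 1) +
      #(univ.filter fun ε : Fin 2 → Bool =>
        κ * twist a (fun j => b j ^^ decide (Odd #(univ.filter fun i => ε i && t' i j))) = -1) = 4 := by
    have h := card_filter_add_card_filter_not (s := (univ : Finset (Fin 2 → Bool)))
      (fun ε : Fin 2 → Bool => κ * twist a (fun j => b j ^^ decide (Odd #(univ.filter fun i => ε i && t' i j))) = 1)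
    rw [card_univ, Fintype.card_fun, Fintype.card_bool, Fintype.card_fin] at h
    have e : (univ.filter fun ε : Fin 2 → Bool =>
        ¬ κ * twist a (fun j => b j ^^ decide (Odd #(univ.filter fun i => ε i && t' i j))) = 1) =
        univ.filter fun ε : Fin 2 → Bool =>
          κ * twist a (fun j => b j ^^ decide (Odd #(univ.filter fun i => ε i && t' i j))) = -1 := by
      refine filter_congr fun ε _ => ?_
      rcases hχv (fun j => b j ^^ decide (Odd #(univ.filter fun i => ε i && t' i j))) with h1 | h1 <;> rw [h1] <;> norm_num
    rw [e] at h; exact h.trans (by norm_num)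
  have et' : t' = Fin.cons (t' 0) (Fin.tail t') := (Fin.cons_self_tail t').symm
  have heven1 : Even #(univ.filter fun ε : Fin 2 → Bool =>
      κ * twist a (fun j => b j ^^ decide (Odd #(univ.filter fun i => ε i && t' i j))) = 1) := by
    have hc2 : ∀ w : Fin (6 + 6) → Bool, (fun _ : Fin (6 + 6) → Bool => twist a (t' 0)) w = 1 ∨
        (fun _ : Fin (6 + 6) → Bool => twist a (t' 0)) w = -1 := fun w => twist_eq_one_or a (t' 0)
    have key := tw59_parity_pair (k := 1) (fun w => κ * twist a w) (fun _ => twist a (t' 0)) b (t' 0) (Fin.tail t')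
      (fun ε => hχv _) (fun ε => hc2 b) (fun w => by simp only [twist_bxor_right]; ring)
    rw [et']
    refine key.2 ?_
    by_cases h1 : twist a (t' 0) = -1
    · simp only [h1]
      norm_num [Fintype.card_fun]
    · simp only [h1]
      norm_num
  have h4 : #(univ.filter fun ε : Fin 2 → Bool =>
      κ * twist a (fun j => b j ^^ decide (Odd #(univ.filter fun i => ε i && t' i j))) = -1) =
      4 - #(univ.filter fun ε : Fin 2 → Bool =>
        κ * twist a (fun j => b j ^^ decide (Odd #(univ.filter fun i => ε i && t' i j))) = 1) := by omega
  rw [h4]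
  exact (Nat.even_sub (by omega)).2 (iff_of_true (by decide) heven1)

/-! ### The window is empty -/

/-- A vector different from `0` has a `true` coordinate. [folklore] -/
theorem tw59_exists_coord (γ : Fin (6 + 6) → Bool) (hγ : γ ≠ zeroVec) : ∃ i, γ i = true := by
  by_contra h
  push Not at h
  exact hγ (funext fun i => by change γ i = false; simpa using h i)

/-- **The window `(59/64, 1)` is empty on 12 bits.**  See the module docstring for the proof outline; inputs: `window_twelve_structure`
(gen 13), `tw59_hyperplane`, `tw59_period_mem`, `tw59_quadratic_digit`, `tw59_rel_bent`, `tw59_translation_law`, `tw59_flat3_even`,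
`erm_weight_ge`.  NOT summit progress. [this work] -/
theorem tw59_window_empty (f g : (Fin (6 + 6) → Bool) → Bool) (hf : IsDegLeFun 3 f) (hg : IsDegLeFun 3 g)
    (hlo : (59 / 64 : ℝ) < forrelation f g) (hlt : forrelation f g < 1) : False := by
  classical
  obtain ⟨⟨u', hu'32, hoddg, hoffg, -⟩, ⟨v', hv'32, hoddf, hofff, hwildf⟩⟩ := window_twelve_structure f g hf hg hlo hlt
  have hu' : ∀ x, W (fun y => signOf (g y)) x = (2 : ℝ) ^ 5 * (u' x : ℝ) := fun x => (hu'32 x).trans (by norm_num)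
  have hv' : ∀ x, W (fun y => signOf (f y)) x = (2 : ℝ) ^ 5 * (v' x : ℝ) := fun x => (hv'32 x).trans (by norm_num)
  have hlo' : (59 / 64 : ℝ) < forrelation g f := by
    rwa [Summit.QuantumAdvantage.QuantumAdvantage.Theorems.SignedCubicForrelationNotPrBPP.Negative.HalfQuad.forrelation_comm]
  -- the two odd hyperplanes and their periods
  obtain ⟨γ, tg, htg, hγ0, hPg⟩ := tw59_hyperplane f g hg u' hu' hoddg hlo
  obtain ⟨c, tf, htf, hc0, hPf⟩ := tw59_hyperplane g f hf v' hv' hoddf hlo'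
  have hγc : twist γ c = 1 := tw59_period_mem f g u' v' hu' hv' γ tg hPg hoddg hoffg c tf htf hPf hofff
  have hcγ : twist c γ = 1 := tw59_period_mem g f v' u' hv' hu' c tf hPf hoddf hofff γ tg htg hPg hoffg
  -- the quadratic digits on both sides
  obtain ⟨i, hγi⟩ := tw59_exists_coord γ hγ0
  obtain ⟨j, hcj⟩ := tw59_exists_coord c hc0
  obtain ⟨D, hD, hDig⟩ := tw59_quadratic_digit f g hg u' hu' γ tg hPg i hγi hoffg
  obtain ⟨D', hD', hDig'⟩ := tw59_quadratic_digit g f hf v' hv' c tf hPf j hcj hofff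
  -- `G = σ·1_{P_g}` is relatively bent with an affine translation law
  set G : (Fin (6 + 6) → Bool) → ℝ := fun x => if twist γ x = tg then signOf (D x) else 0 with hGdef
  have hG : ∀ x, G x = if twist γ x = tg then signOf (D x) else 0 := fun x => rfl
  have hbent := tw59_rel_bent f g u' v' hu' hv' γ hγ0 tg htg hPg hoffg c hc0 tf htf hPf hofff hγc D hD hDig G hG hlo
  have htrl := tw59_translation_law f g u' v' hu' hv' γ hγ0 tg htg hPg hoffg c hc0 tf htf hPf hofff hγc D hD hDig G hG hlo
  -- the residual `R = e_g − G`: `W_R = −64 e_f − W_G`, `Σ W_R² = 4096 Σ R² < 4096·1024`, `Σ |R| < 256`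
  set R : (Fin (6 + 6) → Bool) → ℝ := fun x => ((u' x - 2 * sZ (f x) : ℤ) : ℝ) - G x with hR
  have hWR : ∀ z, W R z = -64 * ((v' z - 2 * sZ (g z) : ℤ) : ℝ) - W G z := fun z => tw59_WR_eq f g u' v' hu' hv' G z
  have hRle := tw59_R_sq_le f g u' hu' γ hγ0 tg htg hPg hoffg D hDig G hG
  have hR2 : ∑ x, R x ^ 2 < 1024 := by
    change ∑ x, (((u' x - 2 * sZ (f x) : ℤ) : ℝ) - G x) ^ 2 < 1024; linarith
  have hPars : ∑ z, W R z ^ 2 = 4096 * ∑ x, R x ^ 2 := by rw [sum_W_sq]; norm_num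
  -- `R ∈ 4ℤ` pointwise, hence `Σ |R| ≤ Σ R²/4 < 256` and `|W_R z| < 256`
  have hR4 : ∀ x, ∃ k : ℤ, R x = 4 * (k : ℝ) := by
    intro x
    change ∃ k : ℤ, ((u' x - 2 * sZ (f x) : ℤ) : ℝ) - G x = 4 * (k : ℝ)
    rw [hG x]
    by_cases hx : twist γ x = tg
    · obtain ⟨k, hk⟩ := hDig x ((hPg x).2 hx)
      refine ⟨k, ?_⟩
      rw [if_pos hx, ← tp_sZ_cast]
      have : ((u' x - 2 * sZ (f x) : ℤ) : ℝ) - (sZ (D x) : ℝ) = (((u' x - 2 * sZ (f x) - sZ (D x)) : ℤ) : ℝ) := by push_cast; ring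
      rw [this, hk]; push_cast; ring
    · refine ⟨0, ?_⟩
      rw [if_neg hx, hoffg x (fun h => hx ((hPg x).1 h))]; push_cast; ring
  have habsR : ∀ x, |R x| ≤ R x ^ 2 / 4 := by
    intro x
    obtain ⟨k, hk⟩ := hR4 x
    rw [hk]
    rcases le_or_gt 0 (k : ℝ) with h0 | h0
    · rw [abs_of_nonneg (by linarith)]
      by_cases hk0 : k = 0
      · rw [hk0]; norm_num
      · have : (1 : ℝ) ≤ |(k : ℝ)| := by exact_mod_cast Int.one_le_abs hk0
        rw [abs_of_nonneg h0] at this; nlinarith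
    · rw [abs_of_neg (by linarith)]
      have hk0 : k ≠ 0 := by rintro rfl; norm_num at h0
      have : (1 : ℝ) ≤ |(k : ℝ)| := by exact_mod_cast Int.one_le_abs hk0
      rw [abs_of_neg h0] at this; nlinarith
  have hWRabs : ∀ z, |W R z| < 256 := by
    intro z
    have h1 : |W R z| ≤ ∑ x, |R x| := by
      unfold W
      refine (abs_sum_le_sum_abs _ _).trans (sum_le_sum fun x _ => ?_)
      rw [abs_mul]
      have : |twist x z| = 1 := by rcases twist_eq_one_or x z with h | h <;> rw [h] <;> norm_num
      rw [this, mul_one]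
    have h2 : ∑ x, |R x| ≤ ∑ x, R x ^ 2 / 4 := sum_le_sum fun x _ => habsR x
    rw [← sum_div] at h2
    linarith
  -- the f-side residual on `P_f`: `e_f = σ' + r'`, `4 ∣ r'`
  -- AGREEMENT SET `A = {z ∈ P_f : W_G(z) = 64 σ'(z)}` has `#A < 256`
  set Pf := univ.filter (fun z : Fin (6 + 6) → Bool => twist c z = tf) with hPfdef
  have hPfmem : ∀ z, z ∈ Pf ↔ twist c z = tf := fun z => by rw [hPfdef, mem_filter]; simp
  have hA_pt : ∀ z, twist c z = tf → W G z = 64 * signOf (D' z) → (16384 : ℝ) ≤ W R z ^ 2 := by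
    intro z hz hA
    obtain ⟨k, hk⟩ := hDig' z ((hPf z).2 hz)
    have hsz : ∀ b : Bool, sZ b = 1 ∨ sZ b = -1 := fun b => by cases b <;> simp [sZ]
    -- `W_R z = −64(σ' + 4k) − 64σ' = −64(2σ' + 4k)`, `|2σ' + 4k| ≥ 2`
    have hW : W R z = -64 * (2 * (sZ (D' z) : ℝ) + 4 * (k : ℝ)) := by
      rw [hWR z, hA, ← tp_sZ_cast]
      have : ((v' z - 2 * sZ (g z) : ℤ) : ℝ) = (sZ (D' z) : ℝ) + 4 * (k : ℝ) := by
        have e : v' z - 2 * sZ (g z) = sZ (D' z) + 4 * k := by linarith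
        rw [e]; push_cast; ring
      rw [this]; ring
    rw [hW]
    have h2 : (2 : ℝ) ≤ |2 * (sZ (D' z) : ℝ) + 4 * (k : ℝ)| := by
      have hint : (2 : ℤ) ≤ |2 * sZ (D' z) + 4 * k| := by
        rcases hsz (D' z) with h | h <;> rw [h] <;> rcases le_or_gt 0 k with hk0 | hk0
        · rw [abs_of_nonneg (by omega)]; omega
        · rw [abs_of_neg (by omega)]; omega
        · by_cases hk1 : 1 ≤ k
          · rw [abs_of_nonneg (by omega)]; omega
          · rw [abs_of_neg (by omega)]; omega
        · rw [abs_of_neg (by omega)]; omega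
      have : ((2 : ℤ) : ℝ) ≤ ((|2 * sZ (D' z) + 4 * k| : ℤ) : ℝ) := by exact_mod_cast hint
      push_cast at this; exact this
    nlinarith [sq_abs (2 * (sZ (D' z) : ℝ) + 4 * (k : ℝ)), sq_nonneg (|2 * (sZ (D' z) : ℝ) + 4 * (k : ℝ)| - 2)]
  set A := Pf.filter (fun z => decide (W G z = 64 * signOf (D' z)) = true) with hAdef
  have hAcard : #A < 256 := by
    have h1 : (#A : ℝ) * 16384 ≤ ∑ z, W R z ^ 2 := by
      have h := sum_le_sum fun z (hz : z ∈ A) => by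
        rw [hAdef, mem_filter, hPfmem, decide_eq_true_eq] at hz
        exact hA_pt z hz.1 hz.2
      rw [sum_const, nsmul_eq_mul] at h
      exact h.trans (sum_le_sum_of_subset_of_nonneg (subset_univ _) fun z _ _ => sq_nonneg _)
    have h2 : ∑ z, W R z ^ 2 < 16384 * 256 := by rw [hPars]; linarith
    have h3 : (#A : ℝ) < 256 := by nlinarith
    exact_mod_cast h3
  -- AGREEMENT SET is even on 3-flats of `P_f` ⇒ by the RM bound on the 11-flat it is empty
  set ψ : (Fin (6 + 6) → Bool) → ℝ := fun z => W G z * signOf (D' z) / 64 with hψdef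
  have hψpm : ∀ w, twist c w = tf → (ψ w = 1 ∨ ψ w = -1) := by
    intro w hw
    have hsq : ψ w ^ 2 = 1 := by
      simp only [hψdef]; rw [div_pow, mul_pow, hbent w hw, signOf_sq]; norm_num
    exact mul_self_eq_one_iff.1 (show ψ w * ψ w = 1 by rw [← sq]; exact hsq)
  have hψtr : ∀ m, twist c m = 1 → ∃ (κ : ℝ) (a : Fin (6 + 6) → Bool), (κ = 1 ∨ κ = -1) ∧
      ∀ w, ψ (bxor w m) = κ * twist a w * ψ w := by
    intro m hm
    obtain ⟨κ, a, hκ, hκtr⟩ := htrl m hm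
    -- the quadratic sign `σ'` also translates affinely
    have hdeg : IsDegLeFun 1 (fun x => D' x ^^ D' (bxor x m)) := stub_derivDegree (6 + 6) 1 D' m hD'
    obtain ⟨c₁, b₁, hcb⟩ := stub_affineForm (6 + 6) _ hdeg
    have hsb : signOf b₁ = 1 ∨ signOf b₁ = -1 := by cases b₁ <;> simp [signOf]
    refine ⟨κ * signOf b₁, bxor a c₁, ?_, fun w => ?_⟩
    · rcases hκ with h | h <;> rcases hsb with h' | h' <;> rw [h, h'] <;> norm_num
    · simp only [hψdef]
      rw [hκtr w, twist_bxor_left]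
      have hs : signOf (D' (bxor w m)) = signOf b₁ * twist c₁ w * signOf (D' w) := by
        have h := hcb w
        rw [signOf_xor] at h
        have hsq : signOf (D' w) * signOf (D' w) = 1 := by rw [← sq, signOf_sq]
        linear_combination signOf (D' w) * h - signOf (D' (bxor w m)) * hsq
      rw [hs]; ring
  have hPfne : Pf.Nonempty := by rw [← card_pos, hPfdef, tw59_card_half c hc0 tf htf]; norm_num
  obtain ⟨z₀, hz₀⟩ := hPfne
  set S := univ.filter (fun a : Fin (6 + 6) → Bool => twist c a = 1) with hSdef
  have hSmem : ∀ a, a ∈ S ↔ twist c a = 1 := fun a => by rw [hSdef, mem_filter]; simp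
  have hS0 : zeroVec ∈ S := (hSmem _).2 (twist_zeroVec_right c)
  have hSadd : ∀ x ∈ S, ∀ y ∈ S, bxor x y ∈ S := by
    intro x hx y hy; rw [hSmem] at hx hy ⊢; rw [twist_bxor_right, hx, hy, mul_one]
  have hScard : #S = 2 ^ 11 := by rw [hSdef, tw59_card_half c hc0 1 (Or.inl rfl)]; norm_num
  have hPfimg : Pf = S.image (bxor z₀) := tw59_eq_image Pf S c tf hPfmem hSmem z₀ hz₀
  have hparity : ∀ b ∈ S.image (bxor z₀), ∀ t : Fin (2 + 1) → Fin (6 + 6) → Bool, (∀ i, t i ∈ S) →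
      Even #(univ.filter fun ε : Fin (2 + 1) → Bool =>
        decide (W G (fun jj => b jj ^^ decide (Odd #(univ.filter fun ii => ε ii && t ii jj))) =
          64 * signOf (D' (fun jj => b jj ^^ decide (Odd #(univ.filter fun ii => ε ii && t ii jj))))) = true) := by
    intro b hb t htS
    rw [← hPfimg, hPfmem] at hb
    have h := tw59_flat3_even c tf ψ hψpm hψtr b hb t (fun ii => (hSmem _).1 (htS ii))
    have e : (univ.filter fun ε : Fin (2 + 1) → Bool =>
        decide (W G (fun jj => b jj ^^ decide (Odd #(univ.filter fun ii => ε ii && t ii jj))) =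
          64 * signOf (D' (fun jj => b jj ^^ decide (Odd #(univ.filter fun ii => ε ii && t ii jj))))) = true) =
        univ.filter fun ε : Fin 3 → Bool =>
          ψ (fun jj => b jj ^^ decide (Odd #(univ.filter fun ii => ε ii && t ii jj))) = 1 := by
      refine filter_congr fun ε _ => ?_
      rw [decide_eq_true_eq]
      simp only [hψdef]
      have hsq : signOf (D' (fun jj => b jj ^^ decide (Odd #(univ.filter fun ii => ε ii && t ii jj)))) ^ 2 = 1 := signOf_sq _
      constructor
      · intro hW; rw [hW, mul_assoc, ← sq, hsq]; norm_num
      · intro hψ1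
        have hs1 : ∀ bb : Bool, signOf bb = 1 ∨ signOf bb = -1 := fun bb => by cases bb <;> simp [signOf]
        rcases hs1 (D' (fun jj => b jj ^^ decide (Odd #(univ.filter fun ii => ε ii && t ii jj)))) with h1 | h1 <;>
          rw [h1] at hψ1 ⊢ <;> linarith
    rw [e]; exact h
  have hAempty : ∀ z ∈ Pf, W G z ≠ 64 * signOf (D' z) := by
    intro z hz hzA
    have hex : ∃ x ∈ S.image (bxor z₀), decide (W G x = 64 * signOf (D' x)) = true := ⟨z, hPfimg ▸ hz, decide_eq_true hzA⟩
    have hge := erm_weight_ge 11 2 S hS0 hSadd hScard z₀ (fun x => decide (W G x = 64 * signOf (D' x))) hparity hex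
    rw [← hPfimg] at hge
    have : #A = #((Pf).filter fun x => decide (W G x = 64 * signOf (D' x)) = true) := by rw [hAdef]
    omega
  -- hence `W_G = −64 σ'` on `P_f`, `W_R = −64 (e_f − σ')`, and `e_f = σ'` on `P_f`
  obtain ⟨zw, hzw_odd, hzw1, hzw2⟩ := hwildf
  have hzw : twist c zw = tf := (hPf zw).1 hzw_odd
  have hWG : W G zw = -64 * signOf (D' zw) := by
    have hsq := hbent zw hzw
    have hs1 : signOf (D' zw) = 1 ∨ signOf (D' zw) = -1 := by cases D' zw <;> simp [signOf]
    have hne := hAempty zw ((hPfmem zw).2 hzw)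
    have h64 : W G zw = 64 ∨ W G zw = -64 := by
      have : (W G zw - 64) * (W G zw + 64) = 0 := by nlinarith
      rcases mul_eq_zero.1 this with h | h
      · left; linarith
      · right; linarith
    rcases hs1 with h | h
    · rw [h] at hne ⊢
      rcases h64 with h' | h'
      · exact (hne (by rw [h']; norm_num)).elim
      · rw [h']; norm_num
    · rw [h] at hne ⊢
      rcases h64 with h' | h'
      · rw [h']; norm_num
      · exact (hne (by rw [h']; norm_num)).elim
  obtain ⟨k, hk⟩ := hDig' zw hzw_odd
  have hWRz : W R zw = -64 * (4 * (k : ℝ)) := by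
    rw [hWR zw, hWG, ← tp_sZ_cast]
    have e : v' zw - 2 * sZ (g zw) = sZ (D' zw) + 4 * k := by linarith
    rw [e]; push_cast; ring
  have hk0 : k = 0 := by
    have h := hWRabs zw
    rw [hWRz, abs_mul, abs_mul] at h
    norm_num at h
    have : |(k : ℝ)| < 1 := by linarith
    have h1 : |k| < 1 := by exact_mod_cast this
    have h2 := abs_lt.1 h1
    omega
  have hsz : ∀ b : Bool, sZ b = 1 ∨ sZ b = -1 := fun b => by cases b <;> simp [sZ]
  rcases hsz (D' zw) with h | h
  · exact hzw1 ⟨0, by rw [hk0, h] at hk; linarith⟩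
  · exact hzw2 ⟨0, by rw [hk0, h] at hk; linarith⟩

/-! ### Packaging -/

/-- **`Φ > 59/64 ⇒ Φ = 1` for cubic pairs on `6 + 6` bits.** NOT summit progress. [this work] -/
theorem tw_isolation_5964 (f g : (Fin (6 + 6) → Bool) → Bool) (hf : IsDegLeFun 3 f) (hg : IsDegLeFun 3 g)
    (hΦ : (59 / 64 : ℝ) < forrelation f g) : forrelation f g = 1 := by
  by_contra hne
  have hle : forrelation f g ≤ 1 := (abs_le.1 (SgnForrMem.abs_forrelation_le_one f g)).2
  exact tw59_window_empty f g hf hg hΦ (lt_of_le_of_ne hle hne)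

/-- **On 12 bits, `Φ > 59/64 ⇒ Φ = 1`** for all cubic `f, g : 𝔽₂¹² → 𝔽₂` (at the literal type `Fin 12`).  The tree had `Φ ≥ 953/1024`
(`isolation_twelve_953`); the eight values `945/1024, …, 952/1024` — the whole second dyadic window `(59/64, 15/16)` — are excluded.  A
kernel-checked verdict about the finite slice `n = 12`; NOT summit progress. [this work] -/
theorem isolation_twelve_5964 : ∀ f g : (Fin 12 → Bool) → Bool, IsDegLeFun 3 f → IsDegLeFun 3 g →
    (59 / 64 : ℝ) < forrelation f g → forrelation f g = 1 :=
  fun f g hf hg h => tw_isolation_5964 f g hf hg h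

/-- **`θ₁₂ ≤ 59/64`**, indeed `θ₁₂ ∈ [57/64, 59/64]`: the least isolation threshold for cubic pairs on 12 bits lies between the record
`57/64` (`theta_twelve_bounds`) and `59/64` (`isolation_twelve_5964`).  NOT summit progress. [this work] -/
theorem theta_twelve_closed_5964 : ∃ θ₀ : ℝ, 57 / 64 ≤ θ₀ ∧ θ₀ ≤ 59 / 64 ∧
    IsLeast {θ : ℝ | ∀ f g : (Fin 12 → Bool) → Bool, IsDegLeFun 3 f → IsDegLeFun 3 g →
      θ < forrelation f g → forrelation f g = 1} θ₀ := by
  obtain ⟨θ₀, hθ₀⟩ := theta_exists 12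
  exact ⟨θ₀, theta_twelve_bounds.2 θ₀ hθ₀.1, hθ₀.2 isolation_twelve_5964, hθ₀⟩

/-- **No cubic pair on 12 bits has `Φ ∈ (59/64, 1)`.** NOT summit progress. [this work] -/
theorem no_window_twelve_5964 : ¬ ∃ f g : (Fin 12 → Bool) → Bool, IsDegLeFun 3 f ∧ IsDegLeFun 3 g ∧
    (59 / 64 : ℝ) < forrelation f g ∧ forrelation f g < 1 := by
  rintro ⟨f, g, hf, hg, hlo, hlt⟩
  have h := isolation_twelve_5964 f g hf hg hlo
  linarith

end Summit.QuantumAdvantage.QuantumAdvantage.Theorems.CubicForrelation.NearExactIsExact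

end
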